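import Summits.QuantumFields.BalabanUV.Beta.FP.NearRegionCrossBubble
import Summits.QuantumFields.BalabanUV.Beta.FP.BlockAveragedKernel

/-!
# `BalabanUV.Beta.FP.LegRemainderGaugeTerm` — road «FP» (binder row D1), organisation γ, **THE (R1) GAUGE-TERM POWER COUNTING**
# (owner NOTE R-γ-18 (i) → leaf-05, journal l.30741; LOCATED PLACEMENT L-d1leaf05g18-1 + INTENT, journal l.31222): RHOA-3's windowed `R`-letters
# `B·n^{−2−j}` (j ≤ 2, `FP/NearRegionCrossBubble(Point)`'s `hR0 hR1 hR1' hR2`) for the gauge term `R₁ = −D·G₀·(1−Π)·Dᵀ·Γ` of `FP/SlicePairing.legRem_eq`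
# (R1), from THREE leg letters — a CUBIC translation-invariant leg, an exponentially localised COARSE leg, a long leg with COLUMN-ℓ¹ letters — with
# every difference placed OFF the long leg ([folklore] real analysis on `ℤ⁴`; no road object is typed or touched)

HONEST DEPENDENCY (page 1, mandatory): continuum YM on T⁴ ⇐ BetaPertH ∧ nine spine estimates (0/9 proved); BetaPertH ⇐ (D1) ∧ (D4) ∧
CAP+tail; G-an2-4 gates asym, D1 and NE2/3/4.  HONEST FRAMING (cell contract, verbatim): «discharging `BetaPertH` makes Bałaban's UV
stability UNCONDITIONAL — a real constructive-QFT result; it is NOT the continuum limit and NOT the Clay problem.»  THIS MODULE is elementary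
[folklore] real analysis on `ℤ⁴ = DyadicShell.Pt` over the tree's shell engine (`TransferUV.card_annulus_succ_four_le`, `DyadicShell.sum_Ico_shellSum`,
`FP/NearRegionCrossBubble.sum_annulus_le_of_shell_bound`, `FP/BlockAveragedKernel.sum_box_eq_add_sum_annulus`) BY NAME; every analytic input (the three
legs' letters) is a HYPOTHESIS displayed in the signatures.  It cites nothing, defines nothing, mints no `Prop` fact, 0 sorry.  It is NOT the road
instance (the legs `∇G₀`, `(1−Π)·Dᵀ` = `piC`'s row difference, `Γ = blk (KPerf m) tt` and their letters are the OWNER's ∕ an2 W-4 (ii)'s; the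
identification of the END's `R m` with the (R1) sum is the owner's located conjecture R-γ-18 (ii)), NOT the constraint term `P·Qᵀ·𝓘ᴸ` of (R1),
NOT (pp)∕(rem) for any road piece, NOT hslice, NOT (ASYMP), NOT D1, NOT BetaPertH, NOT continuum, NOT Clay.

ABSOLUTE RULE (cell charter, verbatim): «No internally-minted statement may enter as a cited fact. Every hypothesis is either kernel-proved in this
package or a verbatim quotation of a PUBLISHED theorem with page reference. The manuscript(s) under audit are NOT citable for their own disputed
steps — they are the thing under adjudication; programme-internal (2001/route/tribunal) claims are never citable.»

WHY ∕ THE PLACEMENT (L-d1leaf05g18-1; R-γ-18, `RESIDUAL-FP.md` §2 row 1, §9 #12, §12 (b)).  The gluon-core ledger instances `hL0`–`hL3` need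
`R = P − Γ` with RHOA-3's windowed letters, not a crude bound; (R1) writes `R = −D·G₀·(1−Π)·Dᵀ·Γ + P·Qᵀ·𝓘ᴸ`.  In the gauge term
`R₁(b,b′) = −Σ_x Σ_β [DG₀](b,x)·[(1−Π)Dᵀ](x,β)·Γ(β,b′)`: (i) `[(1−Π)·Dᵀ](x,(q,ν)) = piC n x (q+e_ν) − piC n x q` EXACTLY (Π symmetric) — the divergence
sits on the COARSE leg (`SliceProjectorKernelDiff.norm_piC_sub_left_le_fine`, `33∕n`), never on Γ; (ii) the `p`-difference of `hR1` sits on the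
TRANSLATION-INVARIANT leg `[DG₀]((p,μ),x) = F(p−x)` and moves onto the coarse leg by the reindexing `x ↦ x + e_i` of `ℤ⁴` (`tsum_three_shift`; mixed letter
`norm_piC_sub_sub_le_fine`, `(33∕n)²`); (iii) `hR1′` of the full symmetric `R` is a `p`-difference; only `hR2` puts ONE difference on Γ's column.  So the
long leg enters ONLY through (T0′) `Σ_q |Γ(q,w)| ≤ T₀` and (T1′) `Σ_q |Γ(q,w+e_j) − Γ(q,w)| ≤ T₁` (on the road `T₀ ≍ n²`, `T₁ ≍ n`: (1.115)'s first ∕ second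
entries for the hard-gauge covariance in road units — NOT derivable from `PerfectFFBlockBounded` ∕ `PerfectFFBlockDecay`, which do not see the UV profile;
their suppliers are the lineage's next IR-5′ items).  POWER COUNT, log-free: `Σ_z (‖z‖∞+1)^{−3}e^{−(κ∕n)‖z‖∞} ≤ 1 + 80n∕κ` (degree `−3` against a
scale-`n` exponential is LINEAR in `n` in four dimensions); with `s₀ ≍ n^{−5}`, `s₁ ≍ n^{−6}`:
`(B₀,B₁,B₁′,B₂) = 2A(1+80n∕κ)·(s₀T₀, s₁T₀, s₀T₁, s₁T₁) ≍ (n^{−2}, n^{−3}, n^{−3}, n^{−4})`.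

CONTENT (`F : Pt → ℝ` translation-invariant leg, `S : Pt → Pt → ℝ` coarse leg, `G : Pt → Pt → ℝ` long leg; `0 < κ`, `1 ≤ n`).  §1 `sum_range_exp_le`,
**`sum_box_inv_cube_exp_le`** ∕ **`sum_inv_cube_exp_le`** (the window constant `1 + 80n∕κ`, every finite set); §2 **`sum_cube_conv_exp_le`** (two centres,
`≤ 2(1+80n∕κ)` UNIFORMLY in `p q`: pointwise domination `cube_mul_exp_le_add`, no triangle-inequality loss); §3 finite-partial-sum currency `sum_two_legs_le`,
**`sum_three_legs_le`**; §4 `tsum` currency on `Pt × Pt`: `summable_three_legs`, **`abs_tsum_three_legs_le`**, the reindexing **`tsum_three_shift`**, and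
**THE FOUR RHOA-3 LETTERS** for `ρ p w := Σ'_{(x,q)} F(p−x)·S x q·G q w`: `abs_rho_le` (`B₀`), `abs_rho_sub_left_le` (`B₁`), `abs_rho_sub_right_le` (`B₁′`),
`abs_rho_sub_sub_le` (`B₂`).  Unit `b2b-balaban-beta-d1-formalise-leaf-05` (gen 18; D1 formalisation swarm leaf seat, road FP lane IR-5′), 2026-08-21;
`LEAVES-FP.md` row «(R1) GAUGE-TERM POWER COUNTING».  «not in print; our bookkeeping».
-/

noncomputable section

namespace Summit.QuantumFields.BalabanUV.Beta.FP.LegRemainderGaugeTerm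

open Finset Real
open scoped BigOperators
open Literature.Probability.LatticeModels (box annulus zero_mem_box)
open Literature.MathematicalPhysics.QuantumFieldTheory.Balaban1983to89.Beta
open Literature.MathematicalPhysics.QuantumFieldTheory.Balaban1983to89.Beta.TransferUV (card_annulus_succ_four_le)
open Literature.MathematicalPhysics.QuantumFieldTheory.Balaban1983to89.Beta.WindowLog (shellSum)
open DyadicShell (Pt supNorm mem_box_iff mem_annulus_iff supNorm_le_iff supNorm_eq_of_mem_sphere sum_Ico_shellSum supNorm_eq_zero_iff)
open Summit.QuantumFields.BalabanUV.Beta.FP.NearRegionCrossBubble (sum_annulus_le_of_shell_bound)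
open Summit.QuantumFields.BalabanUV.Beta.FP.BlockAveragedKernel (sum_box_eq_add_sum_annulus)
open GradedBubbles (supNorm_neg)

/-! ## §1 The cubic leg against a scale-`n` exponential: `Σ_z (‖z‖∞+1)⁻³·e^{−(κ∕n)‖z‖∞} ≤ 1 + 80·n∕κ` -/

/-- [folklore] THE GEOMETRIC TAIL: `Σ_{r<R} e^{−t(r+1)} ≤ 1∕t` for `t > 0` (`= e^{−t}(1−e^{−tR})∕(1−e^{−t}) ≤ 1∕(e^t − 1) ≤ 1∕t`). -/
theorem sum_range_exp_le {t : ℝ} (ht : 0 < t) (R : ℕ) :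
    ∑ r ∈ Finset.range R, Real.exp (-(t * ((r : ℝ) + 1))) ≤ 1 / t := by
  set x : ℝ := Real.exp (-t) with hx
  have hx0 : 0 ≤ x := (Real.exp_pos _).le
  have hx1 : x < 1 := by rw [hx]; exact Real.exp_lt_one_iff.2 (by linarith)
  have hterm : ∀ r : ℕ, Real.exp (-(t * ((r : ℝ) + 1))) = x * x ^ r := fun r => by
    rw [hx, ← Real.exp_nat_mul, ← Real.exp_add]; congr 1; ring
  simp_rw [hterm, ← Finset.mul_sum]
  have hgeom : ∑ r ∈ Finset.range R, x ^ r ≤ (1 - x)⁻¹ := by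
    rw [← tsum_geometric_of_lt_one hx0 hx1]
    exact (summable_geometric_of_lt_one hx0 hx1).sum_le_tsum _ (fun i _ => pow_nonneg hx0 i)
  calc x * ∑ r ∈ Finset.range R, x ^ r ≤ x * (1 - x)⁻¹ := mul_le_mul_of_nonneg_left hgeom hx0
    _ = 1 / (Real.exp t - 1) := by
        have he : 0 < Real.exp t := Real.exp_pos t
        rw [hx, Real.exp_neg]; field_simp
    _ ≤ 1 / t := by
        apply one_div_le_one_div_of_le ht
        linarith [Real.add_one_le_exp t]

/-- [folklore] **THE WINDOW CONSTANT ON A BOX**: `Σ_{z∈box 4 R} ((‖z‖∞+1)³)⁻¹·e^{−(κ∕n)‖z‖∞} ≤ 1 + 80·n∕κ` — the centre term `1`, then shell by shell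
`#{‖z‖∞ = s} ≤ 80s³` against `(s+1)⁻³e^{−(κ∕n)s} ≤ s⁻³e^{−(κ∕n)s}`, and the geometric tail `80·Σ_{s≥1}e^{−(κ∕n)s} ≤ 80n∕κ`: LINEAR in `n`, no logarithm. -/
theorem sum_box_inv_cube_exp_le {κ : ℝ} (hκ : 0 < κ) {n : ℕ} (hn : 1 ≤ n) (R : ℕ) :
    ∑ z ∈ box 4 R, (((supNorm z : ℝ) + 1) ^ 3)⁻¹ * Real.exp (-(κ / n) * (supNorm z : ℝ)) ≤ 1 + 80 * n / κ := by
  have ht : 0 < κ / n := div_pos hκ (by exact_mod_cast hn)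
  rw [sum_box_eq_add_sum_annulus]
  rw [show (((supNorm (0 : Pt) : ℝ) + 1) ^ 3)⁻¹ * Real.exp (-(κ / n) * (supNorm (0 : Pt) : ℝ)) = 1 by
    rw [supNorm_eq_zero_iff.mpr rfl]; norm_num]
  refine add_le_add le_rfl ?_
  have hshell := sum_annulus_le_of_shell_bound (g := fun z => (((supNorm z : ℝ) + 1) ^ 3)⁻¹ * Real.exp (-(κ / n) * (supNorm z : ℝ)))
    (φ := fun r => (((r : ℝ) + 1) ^ 3)⁻¹ * Real.exp (-((κ / n) * ((r : ℝ) + 1)))) (fun r => by positivity) ?_ R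
  · refine hshell.trans ?_
    calc ∑ r ∈ Finset.range R, 80 * ((r : ℝ) + 1) ^ 3 * ((((r : ℝ) + 1) ^ 3)⁻¹ * Real.exp (-((κ / n) * ((r : ℝ) + 1))))
        = 80 * ∑ r ∈ Finset.range R, Real.exp (-((κ / n) * ((r : ℝ) + 1))) := by
          rw [Finset.mul_sum]
          refine Finset.sum_congr rfl fun r _ => ?_
          have hr : ((r : ℝ) + 1) ^ 3 ≠ 0 := by positivity
          field_simp
      _ ≤ 80 * (1 / (κ / n)) := mul_le_mul_of_nonneg_left (sum_range_exp_le ht R) (by norm_num)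
      _ = 80 * n / κ := by field_simp
  · intro r w hw
    have hs : (supNorm w : ℝ) = (r : ℝ) + 1 := by exact_mod_cast supNorm_eq_of_mem_sphere hw
    rw [hs]
    have h1 : (((r : ℝ) + 1 + 1) ^ 3)⁻¹ ≤ (((r : ℝ) + 1) ^ 3)⁻¹ :=
      inv_anti₀ (by positivity) (pow_le_pow_left₀ (by positivity) (by linarith) 3)
    have h2 : Real.exp (-(κ / n) * ((r : ℝ) + 1)) = Real.exp (-((κ / n) * ((r : ℝ) + 1))) := by ring_nf
    rw [h2]
    exact mul_le_mul_of_nonneg_right h1 (Real.exp_pos _).le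

/-- [folklore] **THE WINDOW CONSTANT, EVERY FINITE SET**: `Σ_{z∈Z} ((‖z‖∞+1)³)⁻¹·e^{−(κ∕n)‖z‖∞} ≤ 1 + 80·n∕κ` (`Z ⊆ box 4 (max ‖z‖∞)`, nonnegative terms). -/
theorem sum_inv_cube_exp_le {κ : ℝ} (hκ : 0 < κ) {n : ℕ} (hn : 1 ≤ n) (Z : Finset Pt) :
    ∑ z ∈ Z, (((supNorm z : ℝ) + 1) ^ 3)⁻¹ * Real.exp (-(κ / n) * (supNorm z : ℝ)) ≤ 1 + 80 * n / κ := by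
  classical
  set R := Z.sup supNorm with hR
  have hsub : Z ⊆ box 4 R := fun z hz => mem_box_iff.mpr (Finset.le_sup (f := supNorm) hz)
  calc ∑ z ∈ Z, (((supNorm z : ℝ) + 1) ^ 3)⁻¹ * Real.exp (-(κ / n) * (supNorm z : ℝ))
      ≤ ∑ z ∈ box 4 R, (((supNorm z : ℝ) + 1) ^ 3)⁻¹ * Real.exp (-(κ / n) * (supNorm z : ℝ)) :=
        Finset.sum_le_sum_of_subset_of_nonneg hsub fun z _ _ => by positivity
    _ ≤ 1 + 80 * n / κ := sum_box_inv_cube_exp_le hκ hn R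

/-! ## §2 The cubic leg centred at `p` against the exponential centred at `q`, uniformly in `p, q` -/

/-- [folklore] POINTWISE DOMINATION: `((‖p−x‖+1)³)⁻¹·e^{−t‖x−q‖} ≤ h(p−x) + h(x−q)` with `h z = ((‖z‖+1)³)⁻¹·e^{−t‖z‖}` — if `‖x−q‖ ≥ ‖p−x‖` the exponential
is below `e^{−t‖p−x‖}`, otherwise the cube is below `((‖x−q‖+1)³)⁻¹`. -/
theorem cube_mul_exp_le_add {t : ℝ} (ht : 0 ≤ t) (p q x : Pt) :
    (((supNorm (p - x) : ℝ) + 1) ^ 3)⁻¹ * Real.exp (-t * (supNorm (x - q) : ℝ))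
      ≤ (((supNorm (p - x) : ℝ) + 1) ^ 3)⁻¹ * Real.exp (-t * (supNorm (p - x) : ℝ))
        + (((supNorm (x - q) : ℝ) + 1) ^ 3)⁻¹ * Real.exp (-t * (supNorm (x - q) : ℝ)) := by
  have hA : 0 ≤ (((supNorm (p - x) : ℝ) + 1) ^ 3)⁻¹ * Real.exp (-t * (supNorm (p - x) : ℝ)) := by positivity
  have hB : 0 ≤ (((supNorm (x - q) : ℝ) + 1) ^ 3)⁻¹ * Real.exp (-t * (supNorm (x - q) : ℝ)) := by positivity
  rcases le_or_gt (supNorm (p - x)) (supNorm (x - q)) with h | h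
  · -- exponential dominated by its value at `p − x`
    have h' : (supNorm (p - x) : ℝ) ≤ supNorm (x - q) := by exact_mod_cast h
    have hexp : Real.exp (-t * (supNorm (x - q) : ℝ)) ≤ Real.exp (-t * (supNorm (p - x) : ℝ)) :=
      Real.exp_le_exp.mpr (by nlinarith)
    calc _ ≤ (((supNorm (p - x) : ℝ) + 1) ^ 3)⁻¹ * Real.exp (-t * (supNorm (p - x) : ℝ)) :=
          mul_le_mul_of_nonneg_left hexp (by positivity)
      _ ≤ _ := le_add_of_nonneg_right hB
  · -- cube dominated by its value at `x − q`
    have h' : (supNorm (x - q) : ℝ) + 1 ≤ (supNorm (p - x) : ℝ) + 1 := by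
      have : (supNorm (x - q) : ℝ) ≤ supNorm (p - x) := by exact_mod_cast h.le
      linarith
    have hcube : (((supNorm (p - x) : ℝ) + 1) ^ 3)⁻¹ ≤ (((supNorm (x - q) : ℝ) + 1) ^ 3)⁻¹ :=
      inv_anti₀ (by positivity) (pow_le_pow_left₀ (by positivity) h' 3)
    calc _ ≤ (((supNorm (x - q) : ℝ) + 1) ^ 3)⁻¹ * Real.exp (-t * (supNorm (x - q) : ℝ)) :=
          mul_le_mul_of_nonneg_right hcube (Real.exp_pos _).le
      _ ≤ _ := le_add_of_nonneg_left hA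

/-- [folklore] a sum of `h(p − x)` over `x ∈ X` is a sum of `h` over an injective image, hence `≤` the window constant. -/
theorem sum_shift_left_le {κ : ℝ} (hκ : 0 < κ) {n : ℕ} (hn : 1 ≤ n) (p : Pt) (X : Finset Pt) :
    ∑ x ∈ X, (((supNorm (p - x) : ℝ) + 1) ^ 3)⁻¹ * Real.exp (-(κ / n) * (supNorm (p - x) : ℝ)) ≤ 1 + 80 * n / κ := by
  classical
  have hinj : Set.InjOn (fun x : Pt => p - x) X := fun a _ b _ h => by simpa using h
  rw [← Finset.sum_image (f := fun z : Pt => (((supNorm z : ℝ) + 1) ^ 3)⁻¹ * Real.exp (-(κ / n) * (supNorm z : ℝ))) hinj]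
  exact sum_inv_cube_exp_le hκ hn _

/-- [folklore] the same for `h(x − q)` (`‖x − q‖∞ = ‖q − x‖∞`). -/
theorem sum_shift_right_le {κ : ℝ} (hκ : 0 < κ) {n : ℕ} (hn : 1 ≤ n) (q : Pt) (X : Finset Pt) :
    ∑ x ∈ X, (((supNorm (x - q) : ℝ) + 1) ^ 3)⁻¹ * Real.exp (-(κ / n) * (supNorm (x - q) : ℝ)) ≤ 1 + 80 * n / κ := by
  have e : ∀ x : Pt, supNorm (x - q) = supNorm (q - x) := fun x => by rw [← supNorm_neg, neg_sub]
  simp_rw [e]; exact sum_shift_left_le hκ hn q X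

/-- [folklore] **THE TWO-CENTRE WINDOW SUM, UNIFORM IN THE CENTRES**: `Σ_{x∈X} ((‖p−x‖∞+1)³)⁻¹·e^{−(κ∕n)‖x−q‖∞} ≤ 2·(1 + 80n∕κ)` for ALL `p q`
and every finite `X` — the convolution of the cubic leg with the scale-`n` exponential is bounded by twice the window constant, whatever the separation of the centres. -/
theorem sum_cube_conv_exp_le {κ : ℝ} (hκ : 0 < κ) {n : ℕ} (hn : 1 ≤ n) (p q : Pt) (X : Finset Pt) :
    ∑ x ∈ X, (((supNorm (p - x) : ℝ) + 1) ^ 3)⁻¹ * Real.exp (-(κ / n) * (supNorm (x - q) : ℝ)) ≤ 2 * (1 + 80 * n / κ) := by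
  have hn0 : (0 : ℝ) < n := by exact_mod_cast hn
  have ht : 0 ≤ κ / n := (div_pos hκ hn0).le
  calc ∑ x ∈ X, (((supNorm (p - x) : ℝ) + 1) ^ 3)⁻¹ * Real.exp (-(κ / n) * (supNorm (x - q) : ℝ))
      ≤ ∑ x ∈ X, ((((supNorm (p - x) : ℝ) + 1) ^ 3)⁻¹ * Real.exp (-(κ / n) * (supNorm (p - x) : ℝ))
          + (((supNorm (x - q) : ℝ) + 1) ^ 3)⁻¹ * Real.exp (-(κ / n) * (supNorm (x - q) : ℝ))) :=
        Finset.sum_le_sum fun x _ => cube_mul_exp_le_add ht p q x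
    _ = _ + _ := Finset.sum_add_distrib
    _ ≤ (1 + 80 * n / κ) + (1 + 80 * n / κ) := add_le_add (sum_shift_left_le hκ hn p X) (sum_shift_right_le hκ hn q X)
    _ = 2 * (1 + 80 * n / κ) := by ring

/-! ## §3 Two and three legs, finite-partial-sum currency -/

section Legs

variable {F : Pt → ℝ} {A κ : ℝ} {n : ℕ}

/-- [folklore] the cubic letter forces `0 ≤ A`. -/
theorem nonneg_of_cubic (hF : ∀ z, |F z| ≤ A / ((supNorm z : ℝ) + 1) ^ 3) : 0 ≤ A := by
  have h := hF 0
  rw [supNorm_eq_zero_iff.mpr rfl] at h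
  norm_num at h
  exact (abs_nonneg _).trans h

/-- [folklore] the coarse letter forces `0 ≤ s`. -/
theorem nonneg_of_coarse {S : Pt → Pt → ℝ} {s : ℝ} (hS : ∀ x q, |S x q| ≤ s * Real.exp (-(κ / n) * (supNorm (x - q) : ℝ))) : 0 ≤ s := by
  have h := hS 0 0
  rw [sub_self, supNorm_eq_zero_iff.mpr rfl] at h
  norm_num at h
  exact (abs_nonneg _).trans h

/-- [folklore] **TWO LEGS**: a cubic translation-invariant leg against an exponentially localised coarse leg —
`Σ_{x∈X} |F(p−x)|·|S x q| ≤ 2A·s·(1 + 80n∕κ)`, uniformly in `p q` and in the finite set `X`. -/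
theorem sum_two_legs_le (hκ : 0 < κ) (hn : 1 ≤ n) (hF : ∀ z, |F z| ≤ A / ((supNorm z : ℝ) + 1) ^ 3)
    {S : Pt → Pt → ℝ} {s : ℝ} (hS : ∀ x q, |S x q| ≤ s * Real.exp (-(κ / n) * (supNorm (x - q) : ℝ)))
    (p q : Pt) (X : Finset Pt) :
    ∑ x ∈ X, |F (p - x)| * |S x q| ≤ 2 * A * s * (1 + 80 * n / κ) := by
  have hA : 0 ≤ A := nonneg_of_cubic hF
  have hs : 0 ≤ s := nonneg_of_coarse hS
  calc ∑ x ∈ X, |F (p - x)| * |S x q|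
      ≤ ∑ x ∈ X, (A / ((supNorm (p - x) : ℝ) + 1) ^ 3) * (s * Real.exp (-(κ / n) * (supNorm (x - q) : ℝ))) :=
        Finset.sum_le_sum fun x _ => mul_le_mul (hF _) (hS _ _) (abs_nonneg _) (by positivity)
    _ = A * s * ∑ x ∈ X, (((supNorm (p - x) : ℝ) + 1) ^ 3)⁻¹ * Real.exp (-(κ / n) * (supNorm (x - q) : ℝ)) := by
        rw [Finset.mul_sum]
        refine Finset.sum_congr rfl fun x _ => ?_
        rw [div_eq_mul_inv]; ring
    _ ≤ A * s * (2 * (1 + 80 * n / κ)) := mul_le_mul_of_nonneg_left (sum_cube_conv_exp_le hκ hn p q X) (by positivity)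
    _ = _ := by ring

/-- [folklore] **THREE LEGS**: `Σ_{x∈X}Σ_{q∈Q} |F(p−x)|·|S x q|·|g q| ≤ 2A·s·(1 + 80n∕κ)·T` whenever the long leg's column `g` has `Σ_{q∈Q}|g q| ≤ T` —
the column-ℓ¹ letter is the ONLY way the long leg enters. -/
theorem sum_three_legs_le (hκ : 0 < κ) (hn : 1 ≤ n) (hF : ∀ z, |F z| ≤ A / ((supNorm z : ℝ) + 1) ^ 3)
    {S : Pt → Pt → ℝ} {s : ℝ} (hS : ∀ x q, |S x q| ≤ s * Real.exp (-(κ / n) * (supNorm (x - q) : ℝ)))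
    {g : Pt → ℝ} {T : ℝ} (Q : Finset Pt) (hg : ∑ q ∈ Q, |g q| ≤ T) (p : Pt) (X : Finset Pt) :
    ∑ x ∈ X, ∑ q ∈ Q, |F (p - x)| * |S x q| * |g q| ≤ 2 * A * s * (1 + 80 * n / κ) * T := by
  have hA : 0 ≤ A := nonneg_of_cubic hF
  have hs : 0 ≤ s := nonneg_of_coarse hS
  have hn0 : (0 : ℝ) < n := by exact_mod_cast hn
  have hW : 0 ≤ 2 * A * s * (1 + 80 * n / κ) := by positivity
  rw [Finset.sum_comm]
  calc ∑ q ∈ Q, ∑ x ∈ X, |F (p - x)| * |S x q| * |g q|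
      = ∑ q ∈ Q, |g q| * ∑ x ∈ X, |F (p - x)| * |S x q| := by
        refine Finset.sum_congr rfl fun q _ => ?_
        rw [Finset.mul_sum]
        exact Finset.sum_congr rfl fun x _ => by ring
    _ ≤ ∑ q ∈ Q, |g q| * (2 * A * s * (1 + 80 * n / κ)) :=
        Finset.sum_le_sum fun q _ => mul_le_mul_of_nonneg_left (sum_two_legs_le hκ hn hF hS p q X) (abs_nonneg _)
    _ = (∑ q ∈ Q, |g q|) * (2 * A * s * (1 + 80 * n / κ)) := by rw [Finset.sum_mul]
    _ ≤ T * (2 * A * s * (1 + 80 * n / κ)) := mul_le_mul_of_nonneg_right hg hW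
    _ = _ := by ring

/-! ## §4 `tsum` currency on `ℤ⁴ × ℤ⁴` and the four RHOA-3 letters -/

/-- [folklore] uniform finite bounds on `Pt × Pt`: every finite `U ⊆ Pt × Pt` lies in `(U.image fst) ×ˢ (U.image snd)`, so the three-leg bound holds on `U`. -/
theorem sum_prod_three_legs_le (hκ : 0 < κ) (hn : 1 ≤ n) (hF : ∀ z, |F z| ≤ A / ((supNorm z : ℝ) + 1) ^ 3)
    {S : Pt → Pt → ℝ} {s : ℝ} (hS : ∀ x q, |S x q| ≤ s * Real.exp (-(κ / n) * (supNorm (x - q) : ℝ)))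
    {g : Pt → ℝ} {T : ℝ} (hg : ∀ Q : Finset Pt, ∑ q ∈ Q, |g q| ≤ T) (p : Pt) (U : Finset (Pt × Pt)) :
    ∑ xq ∈ U, |F (p - xq.1) * S xq.1 xq.2 * g xq.2| ≤ 2 * A * s * (1 + 80 * n / κ) * T := by
  classical
  have hsub : U ⊆ (U.image Prod.fst) ×ˢ (U.image Prod.snd) := fun xq hxq =>
    Finset.mem_product.mpr ⟨Finset.mem_image_of_mem _ hxq, Finset.mem_image_of_mem _ hxq⟩
  calc ∑ xq ∈ U, |F (p - xq.1) * S xq.1 xq.2 * g xq.2|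
      ≤ ∑ xq ∈ (U.image Prod.fst) ×ˢ (U.image Prod.snd), |F (p - xq.1) * S xq.1 xq.2 * g xq.2| :=
        Finset.sum_le_sum_of_subset_of_nonneg hsub fun _ _ _ => abs_nonneg _
    _ = ∑ x ∈ U.image Prod.fst, ∑ q ∈ U.image Prod.snd, |F (p - x)| * |S x q| * |g q| := by
        rw [Finset.sum_product]
        refine Finset.sum_congr rfl fun x _ => Finset.sum_congr rfl fun q _ => ?_
        rw [abs_mul, abs_mul]
    _ ≤ _ := sum_three_legs_le hκ hn hF hS _ (hg _) p _

/-- [folklore] **SUMMABILITY** of the three-leg kernel on `ℤ⁴ × ℤ⁴` (absolute, from the uniform finite bounds). -/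
theorem summable_three_legs (hκ : 0 < κ) (hn : 1 ≤ n) (hF : ∀ z, |F z| ≤ A / ((supNorm z : ℝ) + 1) ^ 3)
    {S : Pt → Pt → ℝ} {s : ℝ} (hS : ∀ x q, |S x q| ≤ s * Real.exp (-(κ / n) * (supNorm (x - q) : ℝ)))
    {g : Pt → ℝ} {T : ℝ} (hg : ∀ Q : Finset Pt, ∑ q ∈ Q, |g q| ≤ T) (p : Pt) :
    Summable fun xq : Pt × Pt => F (p - xq.1) * S xq.1 xq.2 * g xq.2 := by
  refine Summable.of_abs ?_
  exact summable_of_sum_le (fun _ => abs_nonneg _) (sum_prod_three_legs_le hκ hn hF hS hg p)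

/-- [folklore] **THE THREE-LEG `tsum` BOUND**: `|Σ'_{(x,q)} F(p−x)·S x q·g q| ≤ 2A·s·(1 + 80n∕κ)·T`. -/
theorem abs_tsum_three_legs_le (hκ : 0 < κ) (hn : 1 ≤ n) (hF : ∀ z, |F z| ≤ A / ((supNorm z : ℝ) + 1) ^ 3)
    {S : Pt → Pt → ℝ} {s : ℝ} (hS : ∀ x q, |S x q| ≤ s * Real.exp (-(κ / n) * (supNorm (x - q) : ℝ)))
    {g : Pt → ℝ} {T : ℝ} (hg : ∀ Q : Finset Pt, ∑ q ∈ Q, |g q| ≤ T) (p : Pt) :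
    |∑' xq : Pt × Pt, F (p - xq.1) * S xq.1 xq.2 * g xq.2| ≤ 2 * A * s * (1 + 80 * n / κ) * T := by
  have habs : Summable fun xq : Pt × Pt => |F (p - xq.1) * S xq.1 xq.2 * g xq.2| :=
    summable_of_sum_le (fun _ => abs_nonneg _) (sum_prod_three_legs_le hκ hn hF hS hg p)
  calc |∑' xq : Pt × Pt, F (p - xq.1) * S xq.1 xq.2 * g xq.2|
      ≤ ∑' xq : Pt × Pt, |F (p - xq.1) * S xq.1 xq.2 * g xq.2| := by
        have h := norm_tsum_le_tsum_norm (f := fun xq : Pt × Pt => F (p - xq.1) * S xq.1 xq.2 * g xq.2)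
          (by simpa [Real.norm_eq_abs] using habs)
        simpa [Real.norm_eq_abs] using h
    _ ≤ _ := Real.tsum_le_of_sum_le (fun _ => abs_nonneg _) (sum_prod_three_legs_le hκ hn hF hS hg p)

/-- [folklore] **THE REINDEXING THAT MOVES A DIFFERENCE OFF THE TRANSLATION-INVARIANT LEG**: for any shift `u`,
`Σ'_{(x,q)} F(p+u−x)·S x q·g q = Σ'_{(x,q)} F(p−x)·S (x+u) q·g q` (the bijection `x ↦ x + u` of `ℤ⁴`; no summability needed). -/
theorem tsum_three_shift (F : Pt → ℝ) (S : Pt → Pt → ℝ) (g : Pt → ℝ) (p u : Pt) :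
    ∑' xq : Pt × Pt, F (p + u - xq.1) * S xq.1 xq.2 * g xq.2 = ∑' xq : Pt × Pt, F (p - xq.1) * S (xq.1 + u) xq.2 * g xq.2 := by
  let e : Pt × Pt ≃ Pt × Pt := (Equiv.addRight u).prodCongr (Equiv.refl Pt)
  rw [← e.tsum_eq]
  refine tsum_congr fun xq => ?_
  simp only [e, Equiv.prodCongr_apply, Prod.map_fst, Equiv.coe_addRight, Prod.map_snd, Equiv.refl_apply]
  congr 2
  abel_nf

/-- [folklore] a shifted coarse leg keeps a zeroth letter (constant `s₀·e^{(κ∕n)‖u‖∞}`; used only for summability). -/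
theorem shifted_letter (hκ : 0 < κ) (hn : 1 ≤ n) {S : Pt → Pt → ℝ} {s₀ : ℝ}
    (hS0 : ∀ x q, |S x q| ≤ s₀ * Real.exp (-(κ / n) * (supNorm (x - q) : ℝ))) (u x q : Pt) :
    |S (x + u) q| ≤ (s₀ * Real.exp ((κ / n) * (supNorm u : ℝ))) * Real.exp (-(κ / n) * (supNorm (x - q) : ℝ)) := by
  have hn0 : (0 : ℝ) < n := by exact_mod_cast hn
  have ht : 0 ≤ κ / n := (div_pos hκ hn0).le
  have hs₀ : 0 ≤ s₀ := nonneg_of_coarse hS0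
  refine (hS0 (x + u) q).trans ?_
  have htri : (supNorm (x - q) : ℝ) ≤ supNorm (x + u - q) + supNorm u := by
    have h := BlockLegs.supNorm_add_le_real (x + u - q) (-u)
    rw [supNorm_neg] at h
    have e : x + u - q + -u = x - q := by abel
    rwa [e] at h
  rw [mul_assoc, ← Real.exp_add]
  exact mul_le_mul_of_nonneg_left (Real.exp_le_exp.mpr (by nlinarith)) hs₀

variable {S G : Pt → Pt → ℝ} {s₀ s₁ T₀ T₁ : ℝ}

/-- [our object] **`hR0` — THE ZEROTH LETTER**: for `ρ p w := Σ'_{(x,q)} F(p−x)·S x q·G q w`,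
`|ρ p w| ≤ 2A·(1 + 80n∕κ)·s₀·T₀` (coarse leg's size `s₀`, long leg's column-ℓ¹ letter `T₀`; on the road `≍ n·n^{−5}·n² = n^{−2}`). -/
theorem abs_rho_le (hκ : 0 < κ) (hn : 1 ≤ n) (hF : ∀ z, |F z| ≤ A / ((supNorm z : ℝ) + 1) ^ 3)
    (hS0 : ∀ x q, |S x q| ≤ s₀ * Real.exp (-(κ / n) * (supNorm (x - q) : ℝ)))
    (hT0 : ∀ (w : Pt) (Q : Finset Pt), ∑ q ∈ Q, |G q w| ≤ T₀) (p w : Pt) :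
    |∑' xq : Pt × Pt, F (p - xq.1) * S xq.1 xq.2 * G xq.2 w| ≤ 2 * A * (1 + 80 * n / κ) * s₀ * T₀ := by
  have h := abs_tsum_three_legs_le hκ hn hF hS0 (g := fun q => G q w) (hT0 w) p
  calc _ ≤ 2 * A * s₀ * (1 + 80 * n / κ) * T₀ := h
    _ = _ := by ring

/-- [our object] **`hR1` — ONE DIFFERENCE IN THE ROW VARIABLE** lands on the coarse leg (`tsum_three_shift`):
`|ρ (p+u) w − ρ p w| ≤ 2A·(1 + 80n∕κ)·s₁·T₀` whenever `|S (x+u) q − S x q| ≤ s₁·e^{−(κ∕n)‖x−q‖∞}` (on the road `u = e_i`, `s₁ ≍ n^{−6}`, letter `≍ n^{−3}`). -/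
theorem abs_rho_sub_left_le (hκ : 0 < κ) (hn : 1 ≤ n) (hF : ∀ z, |F z| ≤ A / ((supNorm z : ℝ) + 1) ^ 3)
    (hS0 : ∀ x q, |S x q| ≤ s₀ * Real.exp (-(κ / n) * (supNorm (x - q) : ℝ))) (u : Pt)
    (hS1 : ∀ x q, |S (x + u) q - S x q| ≤ s₁ * Real.exp (-(κ / n) * (supNorm (x - q) : ℝ)))
    (hT0 : ∀ (w : Pt) (Q : Finset Pt), ∑ q ∈ Q, |G q w| ≤ T₀) (p w : Pt) :
    |(∑' xq : Pt × Pt, F (p + u - xq.1) * S xq.1 xq.2 * G xq.2 w) - ∑' xq : Pt × Pt, F (p - xq.1) * S xq.1 xq.2 * G xq.2 w|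
      ≤ 2 * A * (1 + 80 * n / κ) * s₁ * T₀ := by
  rw [tsum_three_shift F S (fun q => G q w) p u]
  have hsum1 : Summable fun xq : Pt × Pt => F (p - xq.1) * S (xq.1 + u) xq.2 * G xq.2 w :=
    summable_three_legs hκ hn hF (shifted_letter hκ hn hS0 u) (g := fun q => G q w) (hT0 w) p
  have hsum0 : Summable fun xq : Pt × Pt => F (p - xq.1) * S xq.1 xq.2 * G xq.2 w :=
    summable_three_legs hκ hn hF hS0 (g := fun q => G q w) (hT0 w) p
  rw [← hsum1.tsum_sub hsum0]
  have e : (fun xq : Pt × Pt => F (p - xq.1) * S (xq.1 + u) xq.2 * G xq.2 w - F (p - xq.1) * S xq.1 xq.2 * G xq.2 w)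
      = fun xq : Pt × Pt => F (p - xq.1) * (S (xq.1 + u) xq.2 - S xq.1 xq.2) * G xq.2 w := by
    funext xq; ring
  rw [e]
  have h := abs_tsum_three_legs_le hκ hn hF (S := fun x q => S (x + u) q - S x q) hS1 (g := fun q => G q w) (hT0 w) p
  calc _ ≤ 2 * A * s₁ * (1 + 80 * n / κ) * T₀ := h
    _ = _ := by ring

/-- [our object] **`hR1′` — ONE DIFFERENCE IN THE COLUMN VARIABLE** lands on the long leg's differenced column letter (T1′):
`|ρ p (w+v) − ρ p w| ≤ 2A·(1 + 80n∕κ)·s₀·T₁` (on the road `≍ n·n^{−5}·n = n^{−3}`; for the full symmetric `R` this letter is also a row difference). -/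
theorem abs_rho_sub_right_le (hκ : 0 < κ) (hn : 1 ≤ n) (hF : ∀ z, |F z| ≤ A / ((supNorm z : ℝ) + 1) ^ 3)
    (hS0 : ∀ x q, |S x q| ≤ s₀ * Real.exp (-(κ / n) * (supNorm (x - q) : ℝ)))
    (hT0 : ∀ (w : Pt) (Q : Finset Pt), ∑ q ∈ Q, |G q w| ≤ T₀) (v : Pt)
    (hT1 : ∀ (w : Pt) (Q : Finset Pt), ∑ q ∈ Q, |G q (w + v) - G q w| ≤ T₁) (p w : Pt) :
    |(∑' xq : Pt × Pt, F (p - xq.1) * S xq.1 xq.2 * G xq.2 (w + v)) - ∑' xq : Pt × Pt, F (p - xq.1) * S xq.1 xq.2 * G xq.2 w|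
      ≤ 2 * A * (1 + 80 * n / κ) * s₀ * T₁ := by
  have hsum1 : Summable fun xq : Pt × Pt => F (p - xq.1) * S xq.1 xq.2 * G xq.2 (w + v) :=
    summable_three_legs hκ hn hF hS0 (g := fun q => G q (w + v)) (hT0 (w + v)) p
  have hsum0 : Summable fun xq : Pt × Pt => F (p - xq.1) * S xq.1 xq.2 * G xq.2 w :=
    summable_three_legs hκ hn hF hS0 (g := fun q => G q w) (hT0 w) p
  rw [← hsum1.tsum_sub hsum0]
  have e : (fun xq : Pt × Pt => F (p - xq.1) * S xq.1 xq.2 * G xq.2 (w + v) - F (p - xq.1) * S xq.1 xq.2 * G xq.2 w)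
      = fun xq : Pt × Pt => F (p - xq.1) * S xq.1 xq.2 * (G xq.2 (w + v) - G xq.2 w) := by
    funext xq; ring
  rw [e]
  have h := abs_tsum_three_legs_le hκ hn hF hS0 (g := fun q => G q (w + v) - G q w) (hT1 w) p
  calc _ ≤ 2 * A * s₀ * (1 + 80 * n / κ) * T₁ := h
    _ = _ := by ring

/-- [our object] **`hR2` — THE MIXED SECOND DIFFERENCE**: one difference on the coarse leg, one on the long leg's column:
`|ρ(p+u)(w+v) − ρ p (w+v) − ρ (p+u) w + ρ p w| ≤ 2A·(1 + 80n∕κ)·s₁·T₁` (on the road `≍ n·n^{−6}·n = n^{−4}`). -/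
theorem abs_rho_sub_sub_le (hκ : 0 < κ) (hn : 1 ≤ n) (hF : ∀ z, |F z| ≤ A / ((supNorm z : ℝ) + 1) ^ 3)
    (hS0 : ∀ x q, |S x q| ≤ s₀ * Real.exp (-(κ / n) * (supNorm (x - q) : ℝ))) (u : Pt)
    (hS1 : ∀ x q, |S (x + u) q - S x q| ≤ s₁ * Real.exp (-(κ / n) * (supNorm (x - q) : ℝ)))
    (hT0 : ∀ (w : Pt) (Q : Finset Pt), ∑ q ∈ Q, |G q w| ≤ T₀) (v : Pt)
    (hT1 : ∀ (w : Pt) (Q : Finset Pt), ∑ q ∈ Q, |G q (w + v) - G q w| ≤ T₁) (p w : Pt) :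
    |(∑' xq : Pt × Pt, F (p + u - xq.1) * S xq.1 xq.2 * G xq.2 (w + v))
        - (∑' xq : Pt × Pt, F (p - xq.1) * S xq.1 xq.2 * G xq.2 (w + v))
        - (∑' xq : Pt × Pt, F (p + u - xq.1) * S xq.1 xq.2 * G xq.2 w)
        + ∑' xq : Pt × Pt, F (p - xq.1) * S xq.1 xq.2 * G xq.2 w|
      ≤ 2 * A * (1 + 80 * n / κ) * s₁ * T₁ := by
  rw [tsum_three_shift F S (fun q => G q (w + v)) p u, tsum_three_shift F S (fun q => G q w) p u]
  have hS0' := shifted_letter hκ hn hS0 u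
  have hA1 : Summable fun xq : Pt × Pt => F (p - xq.1) * S (xq.1 + u) xq.2 * G xq.2 (w + v) :=
    summable_three_legs hκ hn hF hS0' (g := fun q => G q (w + v)) (hT0 (w + v)) p
  have hA0 : Summable fun xq : Pt × Pt => F (p - xq.1) * S xq.1 xq.2 * G xq.2 (w + v) :=
    summable_three_legs hκ hn hF hS0 (g := fun q => G q (w + v)) (hT0 (w + v)) p
  have hB1 : Summable fun xq : Pt × Pt => F (p - xq.1) * S (xq.1 + u) xq.2 * G xq.2 w :=
    summable_three_legs hκ hn hF hS0' (g := fun q => G q w) (hT0 w) p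
  have hB0 : Summable fun xq : Pt × Pt => F (p - xq.1) * S xq.1 xq.2 * G xq.2 w :=
    summable_three_legs hκ hn hF hS0 (g := fun q => G q w) (hT0 w) p
  rw [← hA1.tsum_sub hA0, ← (hA1.sub hA0).tsum_sub hB1, ← ((hA1.sub hA0).sub hB1).tsum_add hB0]
  have e : (fun xq : Pt × Pt => F (p - xq.1) * S (xq.1 + u) xq.2 * G xq.2 (w + v) - F (p - xq.1) * S xq.1 xq.2 * G xq.2 (w + v)
        - F (p - xq.1) * S (xq.1 + u) xq.2 * G xq.2 w + F (p - xq.1) * S xq.1 xq.2 * G xq.2 w)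
      = fun xq : Pt × Pt => F (p - xq.1) * (S (xq.1 + u) xq.2 - S xq.1 xq.2) * (G xq.2 (w + v) - G xq.2 w) := by
    funext xq; ring
  rw [e]
  have h := abs_tsum_three_legs_le hκ hn hF (S := fun x q => S (x + u) q - S x q) hS1 (g := fun q => G q (w + v) - G q w) (hT1 w) p
  calc _ ≤ 2 * A * s₁ * (1 + 80 * n / κ) * T₁ := h
    _ = _ := by ring

end Legs

end Summit.QuantumFields.BalabanUV.Beta.FP.LegRemainderGaugeTerm

end
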